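import Summits.CriticalPhenomena.PercolationContinuityZ3.Theorems.PercNearOneGluingNoHeavyLowerTailKnQuestion8CoefficientwiseOffCluster
import HarnessLib

/-!
# The domination-pairing principle for two-colouring `T`-sums (NC* by an injection) — prim-lf-2 gen 65

Support file (`--supports stmt-CriticalPhenomena-4575`, closed), prover `prim-lf-2` (gen 65).  No definitions, no named facts, no sorries; standard axioms.
Memo `prim-lf-2/CW-NCDOWN-gen65.md` §4 (and CW-NCA-gen63 §5, where it is used for cycles).

Setting (as in `…CoefficientwiseNCAGlue.lean`): a finite multigraph `ends : ι → Sym2 V`, an edge set `E`, a root `x`; for a colouring `s ⊆ E`, `K s = C_x(s)` (red cluster),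
`B s = K (E ∖ s)` (blue cluster), `M = K ∪ B`, `Z = K ∩ B`, and `T(s) = (f (K s) − f (B s))(g (K s) − g (B s))` for monotone `f, g`.  If `K s` and `B s` are `⊆`-comparable
then `T(s) ≥ 0`.  A colouring `t` DOMINATES `s` if `M_s ⊆ K t` and `B t ⊆ Z_s` (or the mirror image `M_s ⊆ B t`, `K t ⊆ Z_s`); then `T(s) + T(t) ≥ 0` for ALL monotone
`f, g`, because `f (K t) − f (B t) ≥ max(f K_s, f B_s) − min(f K_s, f B_s) = |f K_s − f B_s|`.
* `Coefficientwise.tsum_add_tsum_nonneg_of_dominates` — the two-term inequality.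
* `Coefficientwise.tsum_nonneg_of_dominating_injection` — **DOMINATION PAIRING.**  If an event `Ev` (any finset of colourings) admits a map `φ` sending each member
  with incomparable clusters to a member of `Ev` dominating it, injectively, then `0 ≤ Σ_{s ∈ Ev} T(s)` for all monotone `f, g`.
This is the weight-free mechanism behind NC* on cycles (CW-NCA-gen63 §5: recolour the blue run red and its terminator blue — `K ↦ M`, `B ↦ {x}`); prim-lf-2 gen 65
(`dommat.c`, Hopcroft–Karp) finds such dominating matchings for every target set `W` on all rooted graphs with ≤ 4 vertices and on 51 of the 55 rooted connected graphs with
5 vertices and ≤ 8 edges (the 4 exceptions, e.g. `C₄` + pendant `02 03 04 12 13`, need genuine cancellation), so it is a sufficient mechanism, not the general one.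
[cite: KozmaNitzan2024, Questions 8–9 (§5.5 p. 36) (context: the Question-8 pocket covariance programme)]
-/

namespace Summit.CriticalPhenomena.PercolationContinuityZ3.Theorems

open Finset Literature.Probability.Percolation

namespace Coefficientwise

variable {ι V : Type*}

/-- **Two-term domination inequality.**  If `K ∪ B ⊆ K'` and `B' ⊆ K ∩ B`, or `K ∪ B ⊆ B'` and `K' ⊆ K ∩ B`, then for monotone `f, g`:
`0 ≤ (f K − f B)(g K − g B) + (f K' − f B')(g K' − g B')`. [folklore] -/
theorem tsum_add_tsum_nonneg_of_dominates (K B K' B' : Set V) (f g : Set V → ℝ) (hf : Monotone f) (hg : Monotone g)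
    (hdom : (K ∪ B ⊆ K' ∧ B' ⊆ K ∩ B) ∨ (K ∪ B ⊆ B' ∧ K' ⊆ K ∩ B)) :
    0 ≤ (f K - f B) * (g K - g B) + (f K' - f B') * (g K' - g B') := by
  -- `|f K − f B| ≤ |f K' − f B'|` with the sign of `f K' − f B'` fixed by the orientation, and the same for `g`
  have key : ∀ (φ : Set V → ℝ), Monotone φ →
      |φ K - φ B| ≤ |φ K' - φ B'| ∧ ((K ∪ B ⊆ K' ∧ B' ⊆ K ∩ B) → 0 ≤ φ K' - φ B') ∧ ((K ∪ B ⊆ B' ∧ K' ⊆ K ∩ B) → φ K' - φ B' ≤ 0) := by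
    intro φ hφ
    rcases hdom with ⟨h1, h2⟩ | ⟨h1, h2⟩
    · have a1 : φ K ≤ φ K' := hφ (Set.subset_union_left.trans h1)
      have a2 : φ B ≤ φ K' := hφ (Set.subset_union_right.trans h1)
      have a3 : φ B' ≤ φ K := hφ (h2.trans Set.inter_subset_left)
      have a4 : φ B' ≤ φ B := hφ (h2.trans Set.inter_subset_right)
      refine ⟨?_, fun _ => by linarith, fun h => ?_⟩
      · rw [abs_le]; constructor
        · have : |φ K' - φ B'| = φ K' - φ B' := abs_of_nonneg (by linarith)
          rw [this]; linarith
        · have : |φ K' - φ B'| = φ K' - φ B' := abs_of_nonneg (by linarith)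
          rw [this]; linarith
      · -- both orientations at once force `K' = B'`-type degeneracy; the bound still holds
        have b1 : φ K ≤ φ B' := hφ (Set.subset_union_left.trans h.1)
        have b3 : φ K' ≤ φ K := hφ (h.2.trans Set.inter_subset_left)
        linarith
    · have a1 : φ K ≤ φ B' := hφ (Set.subset_union_left.trans h1)
      have a2 : φ B ≤ φ B' := hφ (Set.subset_union_right.trans h1)
      have a3 : φ K' ≤ φ K := hφ (h2.trans Set.inter_subset_left)
      have a4 : φ K' ≤ φ B := hφ (h2.trans Set.inter_subset_right)
      refine ⟨?_, fun h => ?_, fun _ => by linarith⟩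
      · rw [abs_le]; constructor
        · have : |φ K' - φ B'| = -(φ K' - φ B') := abs_of_nonpos (by linarith)
          rw [this]; linarith
        · have : |φ K' - φ B'| = -(φ K' - φ B') := abs_of_nonpos (by linarith)
          rw [this]; linarith
      · have b1 : φ K ≤ φ K' := hφ (Set.subset_union_left.trans h.1)
        have b3 : φ B' ≤ φ K := hφ (h.2.trans Set.inter_subset_left)
        linarith
  obtain ⟨hfabs, hfpos, hfneg⟩ := key f hf
  obtain ⟨hgabs, hgpos, hgneg⟩ := key g hg
  -- the second product equals `|f K' − f B'|·|g K' − g B'|` (same signs), which dominates `|f K − f B|·|g K − g B| ≥ −(f K − f B)(g K − g B)`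
  have hprod : |f K' - f B'| * |g K' - g B'| = (f K' - f B') * (g K' - g B') := by
    rcases hdom with h | h
    · rw [abs_of_nonneg (hfpos h), abs_of_nonneg (hgpos h)]
    · rw [abs_of_nonpos (hfneg h), abs_of_nonpos (hgneg h), neg_mul_neg]
  have h1 : |f K - f B| * |g K - g B| ≤ |f K' - f B'| * |g K' - g B'| :=
    mul_le_mul hfabs hgabs (abs_nonneg _) (abs_nonneg _)
  have h2 : -((f K - f B) * (g K - g B)) ≤ |f K - f B| * |g K - g B| := by
    rw [← abs_mul]; exact neg_le_abs _
  linarith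

open Classical in
/-- **DOMINATION PAIRING.**  Let `Ev` be a finset of colourings and `φ : Finset ι → Finset ι` such that for every `s ∈ Ev` whose clusters `C_x(s)`, `C_x(E∖s)` are
`⊆`-incomparable, `φ s ∈ Ev` dominates `s` (`C_x(s) ∪ C_x(E∖s) ⊆ C_x(φ s)` and `C_x(E ∖ φ s) ⊆ C_x(s) ∩ C_x(E∖s)`, or the mirror image), and `φ` is injective on these
`s`.  Then `0 ≤ Σ_{s ∈ Ev} (f (C_x s) − f (C_x(E∖s)))(g (C_x s) − g (C_x(E∖s)))` for all monotone `f, g`.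
[cite: KozmaNitzan2024, Questions 8–9 (§5.5 p. 36) (context)] -/
theorem tsum_nonneg_of_dominating_injection [DecidableEq ι] (ends : ι → Sym2 V) (E : Finset ι) (x : V) (Ev : Finset (Finset ι))
    (φ : Finset ι → Finset ι)
    (hdom : ∀ s ∈ Ev, ¬ (openCluster (ends '' (↑s : Set ι)) x ⊆ openCluster (ends '' (↑(E \ s) : Set ι)) x) →
      ¬ (openCluster (ends '' (↑(E \ s) : Set ι)) x ⊆ openCluster (ends '' (↑s : Set ι)) x) →
      φ s ∈ Ev ∧
      ((openCluster (ends '' (↑s : Set ι)) x ∪ openCluster (ends '' (↑(E \ s) : Set ι)) x ⊆ openCluster (ends '' (↑(φ s) : Set ι)) x ∧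
        openCluster (ends '' (↑(E \ φ s) : Set ι)) x ⊆ openCluster (ends '' (↑s : Set ι)) x ∩ openCluster (ends '' (↑(E \ s) : Set ι)) x) ∨
       (openCluster (ends '' (↑s : Set ι)) x ∪ openCluster (ends '' (↑(E \ s) : Set ι)) x ⊆ openCluster (ends '' (↑(E \ φ s) : Set ι)) x ∧
        openCluster (ends '' (↑(φ s) : Set ι)) x ⊆ openCluster (ends '' (↑s : Set ι)) x ∩ openCluster (ends '' (↑(E \ s) : Set ι)) x)))
    (hinj : ∀ s ∈ Ev, ∀ s' ∈ Ev,
      ¬ (openCluster (ends '' (↑s : Set ι)) x ⊆ openCluster (ends '' (↑(E \ s) : Set ι)) x) →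
      ¬ (openCluster (ends '' (↑(E \ s) : Set ι)) x ⊆ openCluster (ends '' (↑s : Set ι)) x) →
      ¬ (openCluster (ends '' (↑s' : Set ι)) x ⊆ openCluster (ends '' (↑(E \ s') : Set ι)) x) →
      ¬ (openCluster (ends '' (↑(E \ s') : Set ι)) x ⊆ openCluster (ends '' (↑s' : Set ι)) x) →
      φ s = φ s' → s = s')
    (f g : Set V → ℝ) (hf : Monotone f) (hg : Monotone g) :
    0 ≤ ∑ s ∈ Ev, (f (openCluster (ends '' (↑s : Set ι)) x) - f (openCluster (ends '' (↑(E \ s) : Set ι)) x)) *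
        (g (openCluster (ends '' (↑s : Set ι)) x) - g (openCluster (ends '' (↑(E \ s) : Set ι)) x)) := by
  set K : Finset ι → Set V := fun s => openCluster (ends '' (↑s : Set ι)) x with hK
  set F : Finset ι → ℝ := fun s => (f (K s) - f (K (E \ s))) * (g (K s) - g (K (E \ s))) with hF
  change 0 ≤ ∑ s ∈ Ev, F s
  -- split the event into incomparable and comparable colourings
  set inc : Finset ι → Prop := fun s => ¬ (K s ⊆ K (E \ s)) ∧ ¬ (K (E \ s) ⊆ K s) with hinc
  have hcomp_nonneg : ∀ s, ¬ inc s → 0 ≤ F s := by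
    intro s hs
    simp only [hinc, not_and_or, not_not] at hs
    rcases hs with h | h
    · exact mul_nonneg_of_nonpos_of_nonpos (sub_nonpos.mpr (hf h)) (sub_nonpos.mpr (hg h))
    · exact mul_nonneg (sub_nonneg.mpr (hf h)) (sub_nonneg.mpr (hg h))
  rw [← Finset.sum_filter_add_sum_filter_not Ev inc]
  -- the image of the incomparable part lies in the comparable part
  set Inc := Ev.filter inc with hInc
  have himg : Inc.image φ ⊆ Ev.filter (fun s => ¬ inc s) := by
    intro t ht
    obtain ⟨s, hs, rfl⟩ := Finset.mem_image.mp ht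
    obtain ⟨hsEv, hs1, hs2⟩ := Finset.mem_filter.mp hs
    obtain ⟨hmem, hd⟩ := hdom s hsEv hs1 hs2
    refine Finset.mem_filter.mpr ⟨hmem, ?_⟩
    simp only [hinc, not_and_or, not_not]
    rcases hd with ⟨h1, h2⟩ | ⟨h1, h2⟩
    · exact Or.inr ((h2.trans Set.inter_subset_left).trans (Set.subset_union_left.trans h1))
    · exact Or.inl ((h2.trans Set.inter_subset_left).trans (Set.subset_union_left.trans h1))
  have hinjOn : Set.InjOn φ ↑Inc := by
    intro s hs s' hs' h
    obtain ⟨hsEv, hs1, hs2⟩ := Finset.mem_filter.mp (Finset.mem_coe.mp hs)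
    obtain ⟨hs'Ev, hs'1, hs'2⟩ := Finset.mem_filter.mp (Finset.mem_coe.mp hs')
    exact hinj s hsEv s' hs'Ev hs1 hs2 hs'1 hs'2 h
  have hcomp : ∑ s ∈ Inc, F (φ s) ≤ ∑ s ∈ Ev.filter (fun s => ¬ inc s), F s := by
    rw [← Finset.sum_image hinjOn]
    exact Finset.sum_le_sum_of_subset_of_nonneg himg (fun t ht _ => hcomp_nonneg t (Finset.mem_filter.mp ht).2)
  have hpair : 0 ≤ ∑ s ∈ Inc, (F s + F (φ s)) := by
    refine Finset.sum_nonneg fun s hs => ?_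
    obtain ⟨hsEv, hs1, hs2⟩ := Finset.mem_filter.mp hs
    obtain ⟨_, hd⟩ := hdom s hsEv hs1 hs2
    exact tsum_add_tsum_nonneg_of_dominates (K s) (K (E \ s)) (K (φ s)) (K (E \ φ s)) f g hf hg hd
  rw [Finset.sum_add_distrib] at hpair
  linarith

end Coefficientwise

end Summit.CriticalPhenomena.PercolationContinuityZ3.Theorems
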